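import Summits.NavierStokesRegularity.NavierStokesRegularity.Theorems.EfficiencyFloorProductionEfficiencyDecayEfficiencyConcentrationTools
import HarnessLib

/-!
# Crux `EfficiencyFloor.ProductionEfficiencyDecay` (stmt-NavierStokesRegularity-22866), skeleton stub
# `stub_efficiencyConcentration` = support item `EfficiencyFloor.EfficiencyConcentration` (stmt-23111):
# ε-efficient vortex stretching forces enstrophy concentration at the Taylor-type scale

**Statement (route decl, verbatim).** For every `ε > 0` there are `K, δ > 0` such that for every smooth
divergence-free `v : ℝ³ → ℝ³` with `v, Dv, D²v ∈ L²`, enstrophy `Z = ∫|ω|² > 0` (`ω = curl v`),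
palinstrophy `Pal = ∫|∇ω|²_F > 0` and ε-EFFICIENT stretching `∫⟪ω, ∇v ω⟫ ≥ ε Z^{3/4} Pal^{3/4}`, some ball
of radius `K (Z/Pal)^{1/2}` carries at least `δ Z` of the enstrophy.

PROOF (elementary localisation; `K = 3`, `δ = δ(ε, K₆, M)` explicit). Let `λ = (Z/Pal)^{1/2}`.
1. Cauchy–Schwarz `|∫⟪ω,∇v ω⟫| ≤ ‖ω‖²_{L⁴} ‖∇v‖_{L²}` (`Magsanop2026Enstrophy.abs_stretchI_le`) and the
   div–curl identity `‖∇v‖_{L²} = ‖ω‖_{L²}` give `∫|ω|⁴ ≥ ε² Z^{1/2} Pal^{3/2}`.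
2. Cover `ℝ³` by the balls `B(λz, λ)`, `z ∈ ℤ³`, with smooth radial cut-offs `χ_z` (`= 1` on `B̄(λz,λ)`,
   `= 0` off `B(λz,2λ)`, `|∇χ_z| ≤ M/λ`, `Literature.Analysis.Calculus.exists_radial_cutoff_gradient_le`).
   On every finite union `U` of the closed balls, `∫_U |ω|⁴ ≤ Σ_z ∫ |χ_z ω|⁴`, and Ladyzhenskaya's
   inequality for each compactly supported piece (`SobolevWholeSpace.integral_norm_pow_four_le_of_integrable`,
   `K₆` = Mathlib's Gagliardo–Nirenberg–Sobolev constant) gives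
   `∫|χ_z ω|⁴ ≤ K₆³ ‖χ_z ω‖_{L²} ‖∇(χ_z ω)‖³_{L²} ≤ K₆³ (∫_{B_z}|ω|²)^{1/2} y_z^{3/2}`,
   `y_z = 2∫_{B_z}|∇ω|² + 2M²λ⁻²∫_{B_z}|ω|²`, `B_z = B(λz, 3λ)`.
3. If NO ball of radius `3λ` held `δ Z` of enstrophy, then with the bounded overlap (`≤ 343`) of the
   balls `B_z` and `λ⁻² Z = Pal`: `∫|ω|⁴ ≤ K₆³ (δZ)^{1/2} (686 (1+M²) Pal)^{3/2}`, contradicting step 1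
   once `δ^{1/2} K₆³ (686(1+M²))^{3/2} < ε²`.

NOTE: the support item stmt-23111 itself was closed independently (K = 4, continuous partition of unity) in
`Theorems/EfficiencyFloorEfficiencyConcentration.lean` (prover-pub-ns-dss-typer); this file lands the registered
stub BY NAME for the crux skeleton, with the lattice proof (K = 3) built on `…EfficiencyConcentrationTools`.

HONEST FRAMING: a kinematic statement about a single divergence-free field; nothing about Navier–Stokes
dynamics, blow-up or regularity is asserted, and the crux `ProductionEfficiencyDecay` is NOT proved here.
References: O. A. Ladyzhenskaya 1969 (the `L⁴` inequality); standard concentration–compactness bookkeeping.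
[folklore]
-/

-- the problem directory repeats the summit name (`NavierStokesRegularity/NavierStokesRegularity`)
set_option linter.dupNamespace false

noncomputable section

open Set Filter MeasureTheory Topology Metric
open scoped InnerProductSpace ENNReal NNReal ContDiff

namespace Summit.NavierStokesRegularity.NavierStokesRegularity.Theorems

namespace ProductionEfficiencyDecay

open Literature.Analysis.FluidPDE
open Literature.Claims.NS.Magsanop2026 (E3 vortSq gradSq)
open Literature.Claims.NS.LucardoOlivaes2026 (stretchI)
open Summit.NavierStokesRegularity.NavierStokesRegularity.Theorems.Magsanop2026Enstrophy
  (K6_nonneg slice_integrable abs_stretchI_le)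

/-- **ε-efficient stretching forces enstrophy concentration** (registered stub
`stub_efficiencyConcentration` of the crux skeleton, = item stmt-NavierStokesRegularity-23111, verbatim):
for every `ε > 0` there are `K = 3` and `δ = δ(ε) > 0` such that every smooth divergence-free `v` with
`v, Dv, D²v ∈ L²`, `Z, Pal > 0` and `∫⟪ω,∇v ω⟫ ≥ ε Z^{3/4} Pal^{3/4}` has a ball of radius `K (Z/Pal)^{1/2}`
carrying `≥ δ Z` of enstrophy. Kinematics of one field; nothing about NS dynamics is asserted.
[cite: Evans2010, §5.6.1 Thm. 1–2] -/
theorem stub_efficiencyConcentration : ∀ ε : ℝ, 0 < ε → ∃ K δ : ℝ, 0 < K ∧ 0 < δ ∧ ∀ v : EuclideanSpace ℝ (Fin 3) → EuclideanSpace ℝ (Fin 3), ContDiff ℝ (⊤ : ℕ∞) v → Literature.Analysis.FluidPDE.VectorCalculus.IsDivFree v → (∫⁻ x, ‖iteratedFDeriv ℝ 0 v x‖ₑ ^ 2 < ⊤) → (∫⁻ x, ‖iteratedFDeriv ℝ 1 v x‖ₑ ^ 2 < ⊤) → (∫⁻ x, ‖iteratedFDeriv ℝ 2 v x‖ₑ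 ^ 2 < ⊤) → 0 < ∫ x, ‖Literature.Analysis.FluidPDE.curl v x‖ ^ 2 → 0 < ∫ x, Literature.Analysis.FluidPDE.frobeniusNormSq (fderiv ℝ (Literature.Analysis.FluidPDE.curl v) x) → ε * (∫ x, ‖Literature.Analysis.FluidPDE.curl v x‖ ^ 2) ^ (3 / 4 : ℝ) * (∫ x, Literature.Analysis.FluidPDE.frobeniusNormSq (fderiv ℝ (Literature.Analysis.FluidPDE.curl v) x)) ^ (3 / 4 : ℝ) ≤ ∫ x, ⟪Literature.Analysis.FluidPDE.curl v x, fderiv ℝ v x (Literature.Analysis.FluidPDE.curl v x)⟫_ℝ → ∃ a : EuclideanSpace ℝ (Fin 3), δ * ∫ x, ‖Literature.Analysis.FluidPDE.curl v x‖ ^ 2 ≤ ∫ x in Metric.ball a (K * Real.sqrt ((∫ x, ‖Literature.Analysis.FluidPDE.curl v x‖ ^ 2) / ∫ x, Literature.Analysis.FluidPDE.frobeniusNormSq (fderiv ℝ (Literature.Analysis.FluidPDE.curl v) x))), ‖Literature.Analysis.FluidPDE.curl v x‖ ^ 2 := by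
  intro ε hε
  obtain ⟨M, hM0, hcut⟩ := Literature.Analysis.Calculus.exists_radial_cutoff_gradient_le (E := E3)
  set K₆ : ℝ := (SNormLESNormFDerivOfEqConst E3 (volume : Measure E3) 2 : ℝ) with hK₆
  have hK0 : 0 ≤ K₆ := K6_nonneg
  set A : ℝ := K₆ ^ 3 * (686 * (1 + M ^ 2)) ^ (3 / 2 : ℝ) with hA
  have hA0 : 0 ≤ A := by positivity
  set δ : ℝ := (ε ^ 2 / (2 * (A + 1))) ^ 2 with hδdef
  have hδ0 : 0 < δ := by positivity
  have hsqrtδ : Real.sqrt δ = ε ^ 2 / (2 * (A + 1)) := Real.sqrt_sq (by positivity)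
  refine ⟨3, δ, by norm_num, hδ0, ?_⟩
  intro v hv hdiv h0 h1 h2 hZ hP hS
  set Z : ℝ := ∫ x, ‖curl v x‖ ^ 2 with hZdef
  set P : ℝ := ∫ x, frobeniusNormSq (fderiv ℝ (curl v) x) with hPdef
  set lam : ℝ := Real.sqrt (Z / P) with hlamdef
  have hZP : 0 < Z / P := div_pos hZ hP
  have hlam : 0 < lam := Real.sqrt_pos.2 hZP
  have hlam2 : lam ^ 2 = Z / P := Real.sq_sqrt hZP.le
  by_contra hcon
  simp only [not_exists, not_le] at hcon
  -- regularity package of the slice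
  have hv3 : ContDiff ℝ 3 v := hv.of_le (by norm_cast)
  have hv2 : ContDiff ℝ 2 v := hv.of_le (by norm_cast)
  have hω1 : ContDiff ℝ 1 (curl v) := contDiff_curl (n := 1) (by exact_mod_cast hv2)
  obtain ⟨I2, ID, IF, -, I4, -, -⟩ := slice_integrable hv3 h1 h2
  have h0' : ∫⁻ x, ‖v x‖ₑ ^ 2 < ⊤ := by
    refine lt_of_le_of_lt (le_of_eq (lintegral_congr fun x => ?_)) h0
    rw [← ofReal_norm, ← ofReal_norm, norm_iteratedFDeriv_zero]
  -- Step 1: the lower bound `ε² Z^{3/2} P^{3/2} ≤ (∫|ω|⁴) Z`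
  set I4v : ℝ := ∫ x, ‖curl v x‖ ^ 4 with hI4def
  have hI40 : 0 ≤ I4v := integral_nonneg fun x => by positivity
  have hG : gradSq v = Z := integral_frobeniusNormSq_fderiv_eq_integral_norm_curl_sq hv2 hdiv h0' h1 h2
  have hCS := abs_stretchI_le hv3 h1 h2
  rw [hG] at hCS
  have hS' : ε * Z ^ (3 / 4 : ℝ) * P ^ (3 / 4 : ℝ) ≤ Real.sqrt I4v * Real.sqrt Z :=
    (hS.trans (le_abs_self _)).trans hCS
  have hlow : ε ^ 2 * (Z ^ (3 / 2 : ℝ) * P ^ (3 / 2 : ℝ)) ≤ I4v * Z := by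
    have hl0 : 0 ≤ ε * Z ^ (3 / 4 : ℝ) * P ^ (3 / 4 : ℝ) :=
      mul_nonneg (mul_nonneg hε.le (Real.rpow_nonneg hZ.le _)) (Real.rpow_nonneg hP.le _)
    have h := pow_le_pow_left₀ hl0 hS' 2
    rw [mul_pow, mul_pow, mul_pow, Real.sq_sqrt hI40, Real.sq_sqrt hZ.le, rpow_three_quarters_sq hZ.le,
      rpow_three_quarters_sq hP.le] at h
    calc ε ^ 2 * (Z ^ (3 / 2 : ℝ) * P ^ (3 / 2 : ℝ)) = ε ^ 2 * Z ^ (3 / 2 : ℝ) * P ^ (3 / 2 : ℝ) := by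
          ring
      _ ≤ I4v * Z := h
  -- Step 2: lattice centres, cut-offs and the localised pieces
  set c : (Fin 3 → ℤ) → E3 := fun z => WithLp.toLp 2 (fun i => lam * (z i : ℝ)) with hcdef
  have hc : ∀ z i, c z i = lam * (z i : ℝ) := fun z i => rfl
  choose χ hχ using fun z : Fin 3 → ℤ => hcut (c z) lam (2 * lam) hlam (by linarith only [hlam])
  have hMlam : ∀ z y, ‖fderiv ℝ (χ z) y‖ ≤ M / lam := fun z y => by
    have h := (hχ z).2.2.2.2.2.2 y
    rwa [show 2 * lam - lam = lam by ring] at h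
  set a : (Fin 3 → ℤ) → ℝ := fun z => ∫ x in ball (c z) (3 * lam), ‖curl v x‖ ^ 2 with hadef
  set b : (Fin 3 → ℤ) → ℝ := fun z => ∫ x in ball (c z) (3 * lam), ‖fderiv ℝ (curl v) x‖ ^ 2 with hbdef
  set y : (Fin 3 → ℤ) → ℝ := fun z => 2 * b z + 2 * (M / lam) ^ 2 * a z with hydef
  have ha0 : ∀ z, 0 ≤ a z := fun z => integral_nonneg fun x => by positivity
  have hb0 : ∀ z, 0 ≤ b z := fun z => integral_nonneg fun x => by positivity
  have hy0 : ∀ z, 0 ≤ y z := fun z =>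
    add_nonneg (mul_nonneg zero_le_two (hb0 z))
      (mul_nonneg (mul_nonneg zero_le_two (sq_nonneg _)) (ha0 z))
  have hKδ : 0 ≤ K₆ ^ 3 * (δ * Z) ^ (1 / 2 : ℝ) :=
    mul_nonneg (pow_nonneg hK0 3) (Real.rpow_nonneg (mul_nonneg hδ0.le hZ.le) _)
  have haδ : ∀ z, a z ≤ δ * Z := fun z => (hcon (c z)).le
  have hpiece : ∀ z, ∫ x, χ z x ^ 4 * ‖curl v x‖ ^ 4 ≤
      K₆ ^ 3 * (δ * Z) ^ (1 / 2 : ℝ) * y z ^ (3 / 2 : ℝ) := by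
    intro z
    obtain ⟨hsm, hnn, hle1, -, hzero, hcs, -⟩ := hχ z
    have hp := piece_bound hω1 I2 ID (hsm.of_le (by norm_cast)) hcs hnn hle1 hlam hzero (hMlam z)
    calc ∫ x, χ z x ^ 4 * ‖curl v x‖ ^ 4 ≤ K₆ ^ 3 * (a z) ^ (1 / 2 : ℝ) * (y z) ^ (3 / 2 : ℝ) := hp
      _ ≤ K₆ ^ 3 * (δ * Z) ^ (1 / 2 : ℝ) * (y z) ^ (3 / 2 : ℝ) := by
          have h1 : (a z) ^ (1 / 2 : ℝ) ≤ (δ * Z) ^ (1 / 2 : ℝ) :=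
            Real.rpow_le_rpow (ha0 z) (haδ z) (by norm_num)
          have h2 : 0 ≤ (y z) ^ (3 / 2 : ℝ) := Real.rpow_nonneg (hy0 z) _
          have h3 : 0 ≤ K₆ ^ 3 := pow_nonneg hK0 3
          exact mul_le_mul_of_nonneg_right (mul_le_mul_of_nonneg_left h1 h3) h2
  -- sums over finite sets of lattice points
  have hDP : ∫ x, ‖fderiv ℝ (curl v) x‖ ^ 2 ≤ P :=
    integral_mono ID IF fun x => norm_sq_le_frobeniusNormSq _
  have hMZ : (M / lam) ^ 2 * Z = M ^ 2 * P := by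
    rw [div_pow, hlam2]
    field_simp
  have hsumy : ∀ F : Finset (Fin 3 → ℤ), ∑ z ∈ F, y z ≤ 686 * (1 + M ^ 2) * P := by
    intro F
    have hb : ∑ z ∈ F, b z ≤ 343 * ∫ x, ‖fderiv ℝ (curl v) x‖ ^ 2 :=
      sum_setIntegral_ball_latticePt_le hlam hc F ID fun x => by positivity
    have ha : ∑ z ∈ F, a z ≤ 343 * Z :=
      sum_setIntegral_ball_latticePt_le hlam hc F I2 fun x => by positivity
    have hyz : ∀ z ∈ F, y z = 2 * b z + 2 * (M / lam) ^ 2 * a z := fun z _ => rfl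
    have hMl0 : 0 ≤ 2 * (M / lam) ^ 2 := mul_nonneg zero_le_two (sq_nonneg _)
    calc ∑ z ∈ F, y z = 2 * ∑ z ∈ F, b z + 2 * (M / lam) ^ 2 * ∑ z ∈ F, a z := by
          rw [Finset.sum_congr rfl hyz, Finset.sum_add_distrib, ← Finset.mul_sum, ← Finset.mul_sum]
      _ ≤ 2 * (343 * P) + 2 * (M / lam) ^ 2 * (343 * Z) := by
          have h1 : ∑ z ∈ F, b z ≤ 343 * P :=
            hb.trans (mul_le_mul_of_nonneg_left hDP (by norm_num))
          exact add_le_add (mul_le_mul_of_nonneg_left h1 zero_le_two)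
            (mul_le_mul_of_nonneg_left ha hMl0)
      _ = 686 * P + 686 * ((M / lam) ^ 2 * Z) := by ring
      _ = 686 * (1 + M ^ 2) * P := by rw [hMZ]; ring
  -- the bound on every finite union of the closed lattice balls
  set Bnd : ℝ := K₆ ^ 3 * (δ * Z) ^ (1 / 2 : ℝ) * (686 * (1 + M ^ 2) * P) ^ (3 / 2 : ℝ) with hBnd
  set Fn : ℕ → Finset (Fin 3 → ℤ) := fun n =>
    Fintype.piFinset fun _ : Fin 3 => Finset.Icc (-(n : ℤ)) n with hFn
  set U : ℕ → Set E3 := fun n => ⋃ z ∈ Fn n, closedBall (c z) lam with hUdef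
  have hmemU : ∀ n x, x ∈ U n ↔ ∃ z ∈ Fn n, x ∈ closedBall (c z) lam := fun n x => by
    simp only [hUdef, mem_iUnion, exists_prop]
  have hUmeas : ∀ n, MeasurableSet (U n) := fun n =>
    Finset.measurableSet_biUnion _ fun z _ => measurableSet_closedBall
  have hint : ∀ z, Integrable fun x => χ z x ^ 4 * ‖curl v x‖ ^ 4 := by
    intro z
    refine I4.mono' ((((hχ z).1.continuous.pow 4).mul (hω1.continuous.norm.pow 4)).aestronglyMeasurable)
      (ae_of_all _ fun x => ?_)
    have hn0 : 0 ≤ χ z x ^ 4 * ‖curl v x‖ ^ 4 := mul_nonneg (pow_nonneg ((hχ z).2.1 x) 4) (by positivity)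
    rw [Real.norm_eq_abs, abs_of_nonneg hn0]
    have h1 : χ z x ^ 4 ≤ 1 := pow_le_one₀ ((hχ z).2.1 x) ((hχ z).2.2.1 x)
    exact mul_le_of_le_one_left (pow_nonneg (norm_nonneg _) 4) h1
  have hUbound : ∀ n, ∫ x in U n, ‖curl v x‖ ^ 4 ≤ Bnd := by
    intro n
    have hpt : ∀ x, (U n).indicator (fun x => ‖curl v x‖ ^ 4) x ≤
        ∑ z ∈ Fn n, χ z x ^ 4 * ‖curl v x‖ ^ 4 := by
      intro x
      have hterm : ∀ z ∈ Fn n, 0 ≤ χ z x ^ 4 * ‖curl v x‖ ^ 4 := fun z _ =>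
        mul_nonneg (pow_nonneg ((hχ z).2.1 x) 4) (by positivity)
      by_cases hx : x ∈ U n
      · rw [indicator_of_mem hx]
        obtain ⟨z, hzF, hzx⟩ := (hmemU n x).1 hx
        have h1 : χ z x = 1 := (hχ z).2.2.2.1 x (mem_closedBall.1 hzx)
        calc ‖curl v x‖ ^ 4 = χ z x ^ 4 * ‖curl v x‖ ^ 4 := by rw [h1, one_pow, one_mul]
          _ ≤ ∑ z ∈ Fn n, χ z x ^ 4 * ‖curl v x‖ ^ 4 :=
            Finset.single_le_sum (f := fun z => χ z x ^ 4 * ‖curl v x‖ ^ 4) hterm hzF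
      · rw [indicator_of_notMem hx]
        exact Finset.sum_nonneg hterm
    calc ∫ x in U n, ‖curl v x‖ ^ 4 = ∫ x, (U n).indicator (fun x => ‖curl v x‖ ^ 4) x :=
          (integral_indicator (hUmeas n)).symm
      _ ≤ ∫ x, ∑ z ∈ Fn n, χ z x ^ 4 * ‖curl v x‖ ^ 4 :=
          integral_mono (I4.indicator (hUmeas n)) (integrable_finsetSum _ fun z _ => hint z) hpt
      _ = ∑ z ∈ Fn n, ∫ x, χ z x ^ 4 * ‖curl v x‖ ^ 4 := integral_finsetSum _ fun z _ => hint z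
      _ ≤ ∑ z ∈ Fn n, K₆ ^ 3 * (δ * Z) ^ (1 / 2 : ℝ) * y z ^ (3 / 2 : ℝ) :=
          Finset.sum_le_sum fun z _ => hpiece z
      _ = K₆ ^ 3 * (δ * Z) ^ (1 / 2 : ℝ) * ∑ z ∈ Fn n, y z ^ (3 / 2 : ℝ) := by rw [Finset.mul_sum]
      _ ≤ K₆ ^ 3 * (δ * Z) ^ (1 / 2 : ℝ) * (∑ z ∈ Fn n, y z) ^ (3 / 2 : ℝ) :=
          mul_le_mul_of_nonneg_left (sum_rpow_three_halves_le (Fn n) fun z _ => hy0 z) hKδ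
      _ ≤ K₆ ^ 3 * (δ * Z) ^ (1 / 2 : ℝ) * (686 * (1 + M ^ 2) * P) ^ (3 / 2 : ℝ) :=
          mul_le_mul_of_nonneg_left (Real.rpow_le_rpow (Finset.sum_nonneg fun z _ => hy0 z)
            (hsumy (Fn n)) (by norm_num)) hKδ
      _ = Bnd := rfl
  -- pass to the limit along the exhaustion `U n ↑ ℝ³`
  have hmono : Monotone U := by
    intro m n hmn x hx
    obtain ⟨z, hz, hzx⟩ := (hmemU m x).1 hx
    refine (hmemU n x).2 ⟨z, ?_, hzx⟩
    rw [hFn, Fintype.mem_piFinset] at hz ⊢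
    intro i
    have hi := Finset.mem_Icc.1 (hz i)
    have hmn' : (m : ℤ) ≤ n := by exact_mod_cast hmn
    exact Finset.mem_Icc.2 ⟨by linarith only [hi.1, hmn'], hi.2.trans hmn'⟩
  have hunion : (⋃ n, U n) = univ := by
    refine eq_univ_of_forall fun x => ?_
    obtain ⟨z, hz⟩ := exists_dist_latticePt_le hlam hc x
    obtain ⟨n, hn⟩ := exists_nat_ge (∑ i, |z i|)
    refine mem_iUnion.2 ⟨n, (hmemU n x).2 ⟨z, ?_, mem_closedBall.2 hz⟩⟩
    rw [hFn, Fintype.mem_piFinset]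
    intro i
    have hi : |z i| ≤ n :=
      (Finset.single_le_sum (f := fun i => |z i|) (fun i _ => abs_nonneg _) (Finset.mem_univ i)).trans hn
    rw [abs_le] at hi
    exact Finset.mem_Icc.2 hi
  have hI4le : I4v ≤ Bnd := by
    have htend := tendsto_setIntegral_of_monotone (μ := volume) (f := fun x => ‖curl v x‖ ^ 4)
      hUmeas hmono (by rw [hunion]; exact I4.integrableOn)
    rw [hunion, Measure.restrict_univ] at htend
    exact le_of_tendsto' htend hUbound
  -- Step 3: the contradiction
  have hW : 0 < Z ^ (3 / 2 : ℝ) * P ^ (3 / 2 : ℝ) :=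
    mul_pos (Real.rpow_pos_of_pos hZ _) (Real.rpow_pos_of_pos hP _)
  have hBndZ : Bnd * Z = Real.sqrt δ * A * (Z ^ (3 / 2 : ℝ) * P ^ (3 / 2 : ℝ)) := by
    rw [hBnd, hA, Real.mul_rpow hδ0.le hZ.le, Real.mul_rpow (by positivity) hP.le, Real.sqrt_eq_rpow]
    have hZ32 : Z ^ (3 / 2 : ℝ) = Z ^ (1 / 2 : ℝ) * Z := by
      rw [show (3 / 2 : ℝ) = 1 / 2 + 1 by norm_num, Real.rpow_add hZ, Real.rpow_one]
    rw [hZ32]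
    ring
  have hchain : ε ^ 2 * (Z ^ (3 / 2 : ℝ) * P ^ (3 / 2 : ℝ)) ≤
      Real.sqrt δ * A * (Z ^ (3 / 2 : ℝ) * P ^ (3 / 2 : ℝ)) :=
    calc ε ^ 2 * (Z ^ (3 / 2 : ℝ) * P ^ (3 / 2 : ℝ)) ≤ I4v * Z := hlow
      _ ≤ Bnd * Z := mul_le_mul_of_nonneg_right hI4le hZ.le
      _ = Real.sqrt δ * A * (Z ^ (3 / 2 : ℝ) * P ^ (3 / 2 : ℝ)) := hBndZ
  have h1 : ε ^ 2 ≤ Real.sqrt δ * A := le_of_mul_le_mul_right hchain hW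
  rw [hsqrtδ] at h1
  have hA1 : 0 < 2 * (A + 1) := by linarith only [hA0]
  have hfrac : A / (2 * (A + 1)) < 1 := by
    rw [div_lt_one hA1]
    linarith only [hA0]
  have h2 : ε ^ 2 / (2 * (A + 1)) * A < ε ^ 2 :=
    calc ε ^ 2 / (2 * (A + 1)) * A = ε ^ 2 * (A / (2 * (A + 1))) := by ring
      _ < ε ^ 2 * 1 := mul_lt_mul_of_pos_left hfrac (pow_pos hε 2)
      _ = ε ^ 2 := mul_one _
  exact absurd (h1.trans_lt h2) (lt_irrefl _)

end ProductionEfficiencyDecay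

end Summit.NavierStokesRegularity.NavierStokesRegularity.Theorems

end
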